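import Summits.AnomalousDissipation.AnomalousDissipation.Theorems.DenseLoudDesignerForces.Negative.Scaling
import Literature.Analysis.FluidPDE.StatisticalSolution

/-!
# Vocabulary (and first lemma) of the line `ergodic-budget-selection-closing`
# for the crux `BaireTransfer.DenseLoudDesignerForces` (stmt-AnomalousDissipation-1143)

Definitions-only support file plus the card's first lemma `budget_selection` (PROVED; the registered sub-goal this
file discharges), `sqrt_forceEnergy_le` and `IsInvariantMeasure.enlarge`, so that the line's REGISTERED STUBS — landed one by one as
`--supports stmt-AnomalousDissipation-1143` files under `Theorems/` — and the lead's skeleton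
(`Cruxes/DenseLoudDesignerForces/Lines/ergodic-budget-selection-closing.lean`, not importable) speak about the
SAME declarations.  The crux's own objects are the landed `Negative.force` (the steady trigonometric-polynomial
designer force `f_c`) and `Negative.loudSet` / `Negative.LoudAt` (`Theorems/DenseLoudDesignerForces/Negative/`).
This file adds the smooth-ergodic-theory vocabulary of the line (planner's checked skeleton, crux-plan round 2,
triaged ×3; lead reshape v2 of 2026-08-16 changes no definition):

* `Hsp` — the phase space `H = Torus.energySpace (Fin 3)` (mean-zero solenoidal `L²` fields), `rep` (a
  representative of an `L²` class), the observables `enstrophyObs`, and the trajectory time means `energyAvg`,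
  `dissipAvg`;
* `IsNSPhase ν F K φ` — the INTERFACE "compact forward-invariant set `K ⊂ H` of smooth states with its semiflow
  `φ`, whose trajectories are global classical NS_ν(F) solutions" (no existence asserted);
* `IsInvariantMeasure K φ μ` — invariant Borel probability measure carried by `K`;
* `IsLinearizedNSSolutionOn`, `SubExpGrowth`, `ExpDecay`, `IsHyperbolicMeasure` — hyperbolicity of an invariant
  measure ("no zero Lyapunov exponent except the flow direction") stated CLASSICALLY through smooth solutions of
  the linearised Navier–Stokes equation, without Oseledets theory;
* `HasKatokClosing K φ μ` — the output shape of Katok's closing lemma along Pesin sets;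
* `hypLoudSet S E ε j` — forces carrying a loud hyperbolic invariant measure at level `j` (the Transfer `C⁺_H`
  of the idea card is the density of these sets).

No facts are asserted here (the three theorems of §3 are proved).  References: Foias–Manley–Rosa–Temam, *Navier–Stokes Equations and Turbulence*
(2001) Ch. IV–V (invariant measures, time vs ensemble averages); Constantin–Foias (1988) Ch. 4 (the space `H`);
Henry (1981) Ch. 8 (linearisation); Barreira–Pesin, *Introduction to Smooth Ergodic Theory* (2023) Ch. 2,
Thm 11.10 (Lyapunov exponents, Katok closing); Lian–Young, JAMS 25 (2012) (hyperbolic measures of semiflows on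
Hilbert spaces); the route file `Theses/BaireTransfer.lean` (item 1143); the line card
`Cruxes/DenseLoudDesignerForces/Lines/ergodic-budget-selection-closing.md`.
-/

-- `Summit.<Summit>.<Problem>` is the tree's mandated summit-side namespace (CONVENTIONS §2); for this
-- single-conjunct summit the two coincide, so the duplicate is deliberate.
set_option linter.dupNamespace false

noncomputable section

open scoped BigOperators Topology ENNReal InnerProductSpace
open Filter Set Function MeasureTheory

namespace Summit.AnomalousDissipation.AnomalousDissipation.Theorems.DenseLoudDesignerForces.Ergodic

open Literature.Analysis.FunctionSpaces Literature.Analysis.FunctionSpaces.Torus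
open Literature.Analysis.FluidPDE Literature.Analysis.FluidPDE.Torus
open Summit.AnomalousDissipation.AnomalousDissipation.Theses.BaireTransfer
open Summit.AnomalousDissipation.AnomalousDissipation.Theorems.DenseLoudDesignerForces.Negative

/-- The flat unit torus `T³`. -/
local notation "𝕋³" => UnitAddTorus (Fin 3)
/-- Real velocity values. -/
local notation "ℝ³" => EuclideanSpace ℝ (Fin 3)
/-- Complex Fourier coefficient values. -/
local notation "ℂ³" => EuclideanSpace ℂ (Fin 3)

/-! ## §0 Phase space, observables, trajectory means -/

/-- The PHASE SPACE of the line: Constantin–Foias' energy space `H = L²_σ(T³)` of square-integrable, weakly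
divergence-free, MEAN-ZERO vector fields (the tree's `Torus.energySpace`, a closed subspace of `L²(T³; ℝ³)`, Borel
σ-algebra `Torus.instMeasurableSpaceEnergySpace`).  Mean zero is the card's conserved-mean slice at `V = 0`.
[cite: ConstantinFoiasNSE1988, Ch. 4 (the space H)] -/
abbrev Hsp : Type := ↥(energySpace (Fin 3))

/-- A representative `T³ → ℝ³` of a state `v ∈ H` (the `L²` class coerced to a function; integrals and Fourier
coefficients do not depend on the representative). [folklore] -/
@[folklore] def rep (v : Hsp) : 𝕋³ → ℝ³ :=
  ((v : Lp ℝ³ 2 (volume : Measure 𝕋³)) : 𝕋³ → ℝ³)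

/-- The enstrophy observable `‖∇v‖₂²` of a state (spectral `Torus.eGradNormSq`, converted to `ℝ`; junk `0` at
states of infinite enstrophy, which `IsNSPhase.enstrophy_finite` excludes on `K`). [cite: DoeringFoias2002, §2] -/
@[folklore] def enstrophyObs (v : Hsp) : ℝ :=
  (eGradNormSq (rep v)).toReal

/-- Time-mean energy `T⁻¹ ∫₀ᵀ ‖φ_t x‖₂² dt` of the trajectory of `x` under the semiflow `φ`. [cite: DoeringFoias2002, §2] -/
@[folklore] def energyAvg (φ : ℝ → Hsp → Hsp) (x : Hsp) (T : ℝ) : ℝ :=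
  T⁻¹ * ∫ t in (0 : ℝ)..T, ‖φ t x‖ ^ 2

/-- Time-mean dissipation `T⁻¹ ∫₀ᵀ ν‖∇φ_t x‖₂² dt` of the trajectory of `x`. [cite: DoeringFoias2002, §2] -/
@[folklore] def dissipAvg (ν : ℝ) (φ : ℝ → Hsp → Hsp) (x : Hsp) (T : ℝ) : ℝ :=
  T⁻¹ * ∫ t in (0 : ℝ)..T, ν * enstrophyObs (φ t x)

/-! ## §1 The interface: a compact invariant set of strong solutions with its semiflow, invariant measures -/

/-- **NS phase (interface of hypotheses; existence is asserted only by `stub_denseHyperbolicLoudMeasures`).**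
`K ⊂ H` is a compact set of states and `φ : ℝ → H → H` (junk outside `Ici 0 × K`) a semiflow on it such that:
`φ_t` maps `K` into itself (`t ≥ 0`), `φ_0 = id` and `φ_{s+t} = φ_s ∘ φ_t` on `K`, `(t,x) ↦ φ_t x` is jointly
continuous on `Ici 0 × K`, the enstrophy is finite and `L²`-continuous on `K` (true on `H²`-bounded sets by
interpolation — parabolic smoothing makes compact invariant sets of strong solutions bounded in every `H^s`), and
every trajectory is a GLOBAL CLASSICAL solution of NS_ν forced by the steady `F`: for `x ∈ K` there are `u, p`
jointly smooth on `[0,∞) × T³` solving the system with `u(t)` representing `φ_t x`.  At fixed `ν > 0` this is the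
standard dynamical-systems frame of 3-D NS on a compact invariant set of strong solutions (FMRT 2001 Ch. III–IV;
ConstantinFoias 1988). [cite: FMRTTurbulence2001, Ch. IV §2 (invariant measures and stationary statistical solutions)] -/
@[folklore] structure IsNSPhase (ν : ℝ) (F : 𝕋³ → ℝ³) (K : Set Hsp) (φ : ℝ → Hsp → Hsp) : Prop where
  /-- `K` is compact in `H`. -/
  isCompact : IsCompact K
  /-- Forward invariance. -/
  mapsTo : ∀ t : ℝ, 0 ≤ t → MapsTo (φ t) K K
  /-- `φ_0 = id` on `K`. -/
  map_zero : ∀ x ∈ K, φ 0 x = x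
  /-- Semigroup law on `K`. -/
  map_add : ∀ s t : ℝ, 0 ≤ s → 0 ≤ t → ∀ x ∈ K, φ (s + t) x = φ s (φ t x)
  /-- Joint continuity on `Ici 0 × K`. -/
  continuousOn : ContinuousOn (fun q : ℝ × Hsp => φ q.1 q.2) (Ici 0 ×ˢ K)
  /-- Finite enstrophy on `K`. -/
  enstrophy_finite : ∀ x ∈ K, eGradNormSq (rep x) ≠ ∞
  /-- The enstrophy is `L²`-continuous on `K`. -/
  enstrophy_continuousOn : ContinuousOn enstrophyObs K
  /-- Trajectories are global classical NS solutions forced by `F`. -/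
  trajectory : ∀ x ∈ K, ∃ (u : ℝ → 𝕋³ → ℝ³) (p : ℝ → 𝕋³ → ℝ),
    IsClassicalNSSolutionOn (Ici 0) ν (fun _ => F) u p ∧ ∀ t : ℝ, 0 ≤ t → rep (φ t x) =ᵐ[volume] u t

/-- **Invariant probability measure carried by `K`**: `μ` is a Borel probability measure on `H` with `μ(Kᶜ) = 0`
and `(φ_t)_* μ = μ` for `t ≥ 0` (as `Measure.map`; a non-a.e.-measurable `φ_t` would give `map = 0 ≠ μ`, so the
identity also records a.e.-measurability).  Ergodicity is NOT assumed anywhere in the line. [cite: FMRTTurbulence2001, Ch. IV §2 Def. 2.1] -/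
@[folklore] structure IsInvariantMeasure (K : Set Hsp) (φ : ℝ → Hsp → Hsp) (μ : Measure Hsp) : Prop where
  /-- Probability measure. -/
  prob : IsProbabilityMeasure μ
  /-- Carried by `K`. -/
  null_compl : μ Kᶜ = 0
  /-- Invariance under the semiflow. -/
  map_eq : ∀ t : ℝ, 0 ≤ t → Measure.map (φ t) μ = μ

/-! ## §2 Hyperbolicity (classical form) and the closing property -/

/-- **The linearised Navier–Stokes equation along the space–time field `u`** on the time set `S`:
`w, q` jointly smooth on `S × T³`, `w(t)` divergence free and mean zero (in-slice linearisation: the mean is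
conserved because the force is mean-free), and `∂ₜw + (u·∇)w + (w·∇)u = νΔw − ∇q` pointwise.  This is the
derivative cocycle of the NS_ν semiflow written classically (Henry 1981 Ch. 8; the same predicate, with an
inhomogeneity, is `LinNSAround` of the sibling line `RobustLoudUpgrade/Lines/drift-wave-symmetry-upgrade`).
[cite: Henry1981, Ch. 8] -/
@[folklore] def IsLinearizedNSSolutionOn (S : Set ℝ) (ν : ℝ) (u w : ℝ → 𝕋³ → ℝ³) (q : ℝ → 𝕋³ → ℝ) : Prop :=
  IsSmoothSpaceTimeOn S w ∧ IsSmoothSpaceTimeOn S q ∧ (∀ t ∈ S, IsDivFree (w t)) ∧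
    (∀ t ∈ S, HasZeroMean (w t)) ∧
    ∀ t ∈ S, ∀ x, Torus.timeDerivWithin S w t x + convect (u t) (w t) x + convect (w t) (u t) x =
      ν • laplacian (w t) x - Torus.gradient (q t) x

/-- Sub-exponential growth of `t ↦ ‖w(t)‖₂` along integer times: Lyapunov exponent `≤ 0` (stated without
logarithms, so the zero solution qualifies with no junk). [cite: BarreiraPesin2023, Ch. 2 (Lyapunov exponents)] -/
@[folklore] def SubExpGrowth (w : ℝ → 𝕋³ → ℝ³) : Prop :=
  ∀ κ : ℝ, 0 < κ → ∃ C : ℝ, ∀ n : ℕ, ∫ y, ‖w n y‖ ^ 2 ≤ C * Real.exp (κ * n)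

/-- Exponential decay of `t ↦ ‖w(t)‖₂` along integer times: Lyapunov exponent `< 0`. [cite: BarreiraPesin2023, Ch. 2 (Lyapunov exponents)] -/
@[folklore] def ExpDecay (w : ℝ → 𝕋³ → ℝ³) : Prop :=
  ∃ κ : ℝ, 0 < κ ∧ ∃ C : ℝ, ∀ n : ℕ, ∫ y, ‖w n y‖ ^ 2 ≤ C * Real.exp (-(κ * n))

/-- **Hyperbolicity of an invariant measure of the NS_ν(F) semiflow — the chaotic hypothesis (H) in its weakest
usable form, stated classically.**  For `μ`-a.e. `x`, along the classical trajectory `u` of `x`: every solution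
`w` of the linearised equation with sub-exponential growth becomes, after subtracting a suitable multiple of the
FLOW DIRECTION `∂ₜu(0)` from its initial value, exponentially decaying.  At Lyapunov-regular points this says
exactly: the non-positive part of the Oseledets filtration is `ℝ∂ₜu ⊕ (stable)`, i.e. NO ZERO EXPONENT EXCEPT THE
SIMPLE ONE OF THE FLOW DIRECTION (Lian–Young's hypothesis for semiflows; the cocycle is injective and compact by
backward uniqueness and parabolic smoothing, facts the prover of `stub_closingLemma` supplies).  Positive entropy
is not required for closing.  Equilibria (where `∂ₜu = 0`) must then be hyperbolic fixed points. [cite: LianYoung2012, §1 (standing hypotheses: exactly one zero exponent)] -/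
@[folklore] def IsHyperbolicMeasure (ν : ℝ) (F : 𝕋³ → ℝ³) (φ : ℝ → Hsp → Hsp) (μ : Measure Hsp) : Prop :=
  ∀ᵐ x ∂μ, ∀ (u : ℝ → 𝕋³ → ℝ³) (p : ℝ → 𝕋³ → ℝ), IsClassicalNSSolutionOn (Ici 0) ν (fun _ => F) u p →
    (∀ t : ℝ, 0 ≤ t → rep (φ t x) =ᵐ[volume] u t) →
    ∀ (w : ℝ → 𝕋³ → ℝ³) (q : ℝ → 𝕋³ → ℝ), IsLinearizedNSSolutionOn (Ici 0) ν u w q → SubExpGrowth w →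
      ∃ a : ℝ, ∀ (w' : ℝ → 𝕋³ → ℝ³) (q' : ℝ → 𝕋³ → ℝ), IsLinearizedNSSolutionOn (Ici 0) ν u w' q' →
        w' 0 = w 0 - a • Torus.timeDerivWithin (Ici 0) u 0 → ExpDecay w'

/-- **Katok closing along Pesin sets (the OUTPUT SHAPE of the closing lemma for the semiflow `φ` on `K`).**
There are measurable sets `Λ_ℓ ⊆ K` exhausting `μ`-almost all of `H` such that for every `ℓ` and `η > 0` there is
`δ > 0` with: whenever `x ∈ Λ_ℓ` returns at an integer time `n ≥ 1` to `Λ_ℓ` within distance `δ` of itself, some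
`z ∈ K` is periodic under the semiflow with a period `T`, `|T − n| ≤ η`, and its orbit `η`-shadows that of `x` at
the integer times `0 ≤ k ≤ n` (Katok 1980 Main Lemma; Barreira–Pesin 2023 Thm 11.10 and [13, §15.1]; for
semiflows on Hilbert spaces with one zero exponent: Lian–Young 2012). [cite: BarreiraPesin2023, Thm 11.10] -/
@[folklore] def HasKatokClosing (K : Set Hsp) (φ : ℝ → Hsp → Hsp) (μ : Measure Hsp) : Prop :=
  ∃ Λ : ℕ → Set Hsp, (∀ ℓ, MeasurableSet (Λ ℓ)) ∧ (∀ ℓ, Λ ℓ ⊆ K) ∧ μ (⋃ ℓ, Λ ℓ)ᶜ = 0 ∧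
    ∀ ℓ : ℕ, ∀ η : ℝ, 0 < η → ∃ δ : ℝ, 0 < δ ∧
      ∀ x ∈ Λ ℓ, ∀ n : ℕ, 0 < n → φ n x ∈ Λ ℓ → dist (φ n x) x < δ →
        ∃ z ∈ K, ∃ T : ℝ, 0 < T ∧ |T - n| ≤ η ∧ φ T z = z ∧ ∀ k : ℕ, k ≤ n → dist (φ k z) (φ k x) ≤ η

/-- **The set `HYP_j(S,E,ε)` of forces carrying a loud hyperbolic invariant measure at level `j`**: at SOME
`ν ∈ (0, 1/(j+1))` the steady force `f_c` admits an NS phase `(K, φ)` with an invariant probability measure `μ` on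
`K` of ensemble energy `≤ E` (`Torus.ensembleEnergy`), ensemble dissipation `≥ ε` (`Torus.ensembleDissipation`;
its junk value `0` at infinite mean enstrophy only makes the condition fail) which is hyperbolic.  An ergodic loud
hyperbolic measure (the card's `C⁺_H`) is the basic instance; ergodicity is not needed. [cite: FMRTTurbulence2001, Ch. V §1 (ensemble averages)] -/
@[folklore] def hypLoudSet (S : Finset (Fin 3 → ℤ)) (E ε : ℝ) (j : ℕ) : Set (↥S → ℂ³) :=
  {c | ∃ ν : ℝ, 0 < ν ∧ ν < 1 / ((j : ℝ) + 1) ∧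
    ∃ (K : Set Hsp) (φ : ℝ → Hsp → Hsp) (μ : Measure Hsp),
      IsNSPhase ν (force S c) K φ ∧ IsInvariantMeasure K φ μ ∧
        ensembleEnergy μ ≤ E ∧ ε ≤ ensembleDissipation ν μ ∧ IsHyperbolicMeasure ν (force S c) φ μ}

/-! ## §3 Budget selection (the card's first lemma, PROVED), force size on a ball, invariance under enlargement -/

/-- **BUDGET SELECTION** (the card's first lemma; `SketchIdeator5.budget_selection` verbatim but for its unused
hypothesis `D ≥ 0`, PROVED: Markov + Cauchy–Schwarz + splitting).  Over a probability space `P` with "dissipation" `D` and "energy" `En`, the pointwise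
power budget `D ≤ F√En` and the mean budgets `∫D ≥ ε`, `∫En ≤ E` force the cell
`{En ≤ 16F²E²/ε² ∧ D ≥ ε/2}` to have probability `≥ ε²/(16F²E) > 0` — loud trajectories with a
`j`-INDEPENDENT budget inflation are free. [folklore] -/
theorem budget_selection {Ω : Type*} [MeasurableSpace Ω] (P : Measure Ω) [IsProbabilityMeasure P]
    {D En : Ω → ℝ} (hDm : Measurable D) (hEm : Measurable En) (hE0 : ∀ ω, 0 ≤ En ω)
    {F E ε : ℝ} (hF : 0 < F) (hE : 0 < E) (hε : 0 < ε)
    (hpow : ∀ ω, D ω ≤ F * Real.sqrt (En ω)) (hDi : Integrable D P) (hEi : Integrable En P)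
    (hD : ε ≤ ∫ ω, D ω ∂P) (hEn : ∫ ω, En ω ∂P ≤ E) :
    ENNReal.ofReal (ε ^ 2 / (16 * F ^ 2 * E)) ≤ P {ω | En ω ≤ 16 * F ^ 2 * E ^ 2 / ε ^ 2 ∧ ε / 2 ≤ D ω} := by
  set K : ℝ := 4 * F * E / ε with hK
  have hKpos : 0 < K := by positivity
  have hK2 : K ^ 2 = 16 * F ^ 2 * E ^ 2 / ε ^ 2 := by rw [hK]; field_simp; ring
  have hFK : F / K = ε / (4 * E) := by rw [hK]; field_simp
  set B : Set Ω := {ω | En ω ≤ 16 * F ^ 2 * E ^ 2 / ε ^ 2 ∧ ε / 2 ≤ D ω} with hB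
  have hBm : MeasurableSet B :=
    (hEm measurableSet_Iic).inter (hDm measurableSet_Ici)
  -- pointwise domination
  have hind0 : ∀ ω, 0 ≤ B.indicator (fun _ => (1:ℝ)) ω := fun ω =>
    Set.indicator_nonneg (fun _ _ => zero_le_one) ω
  have hpt : ∀ ω, D ω ≤ ε / (4 * E) * En ω + F * K * B.indicator (fun _ => (1:ℝ)) ω + ε / 2 := by
    intro ω
    have h4 : 0 ≤ ε / (4 * E) * En ω := mul_nonneg (by positivity) (hE0 ω)
    have h3 : 0 ≤ F * K * B.indicator (fun _ => (1:ℝ)) ω :=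
      mul_nonneg (mul_nonneg hF.le hKpos.le) (hind0 ω)
    by_cases hA : K ^ 2 < En ω
    · have h1 : K ≤ Real.sqrt (En ω) := by
        rw [← Real.sqrt_sq hKpos.le]; exact Real.sqrt_le_sqrt hA.le
      have hs : Real.sqrt (En ω) * K ≤ En ω := by
        calc Real.sqrt (En ω) * K ≤ Real.sqrt (En ω) * Real.sqrt (En ω) := by
              gcongr
          _ = En ω := Real.mul_self_sqrt (hE0 ω)
      have h2 : F * Real.sqrt (En ω) ≤ ε / (4 * E) * En ω := by
        calc F * Real.sqrt (En ω) = (F / K) * (Real.sqrt (En ω) * K) := by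
              field_simp
          _ ≤ (F / K) * En ω := by gcongr
          _ = ε / (4 * E) * En ω := by rw [hFK]
      linarith [hpow ω]
    · push Not at hA
      have h1 : Real.sqrt (En ω) ≤ K := by
        calc Real.sqrt (En ω) ≤ Real.sqrt (K ^ 2) := Real.sqrt_le_sqrt hA
          _ = K := Real.sqrt_sq hKpos.le
      by_cases hD2 : ε / 2 ≤ D ω
      · have hmem : ω ∈ B := ⟨by rw [← hK2]; exact hA, hD2⟩
        have hind : B.indicator (fun _ => (1:ℝ)) ω = 1 := Set.indicator_of_mem hmem _
        have h2 : F * Real.sqrt (En ω) ≤ F * K := by gcongr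
        rw [hind]; linarith [hpow ω]
      · push Not at hD2
        linarith
  -- integrate the domination
  have hIi : Integrable (fun ω => B.indicator (fun _ => (1:ℝ)) ω) P :=
    (integrable_const (1:ℝ)).indicator hBm
  have hrhs : Integrable (fun ω => ε / (4 * E) * En ω + F * K * B.indicator (fun _ => (1:ℝ)) ω + ε / 2) P :=
    ((hEi.const_mul _).add (hIi.const_mul _)).add (integrable_const _)
  have hint : ∫ ω, D ω ∂P ≤ ε / (4 * E) * (∫ ω, En ω ∂P) + F * K * (P B).toReal + ε / 2 := by
    have step := integral_mono hDi hrhs hpt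
    have h12 : Integrable (fun ω => ε / (4 * E) * En ω + F * K * B.indicator (fun _ => (1:ℝ)) ω) P :=
      (hEi.const_mul _).add (hIi.const_mul _)
    have i1 : ∫ ω, (ε / (4 * E) * En ω + F * K * B.indicator (fun _ => (1:ℝ)) ω + ε / 2) ∂P
        = (∫ ω, (ε / (4 * E) * En ω + F * K * B.indicator (fun _ => (1:ℝ)) ω) ∂P) + ∫ _ω, ε / 2 ∂P :=
      integral_add h12 (integrable_const _)
    have i2 : ∫ ω, (ε / (4 * E) * En ω + F * K * B.indicator (fun _ => (1:ℝ)) ω) ∂P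
        = (∫ ω, ε / (4 * E) * En ω ∂P) + ∫ ω, F * K * B.indicator (fun _ => (1:ℝ)) ω ∂P :=
      integral_add (hEi.const_mul _) (hIi.const_mul _)
    have i3 : ∫ ω, ε / (4 * E) * En ω ∂P = ε / (4 * E) * ∫ ω, En ω ∂P := integral_const_mul _ _
    have i4 : ∫ ω, F * K * B.indicator (fun _ => (1:ℝ)) ω ∂P = F * K * (P B).toReal := by
      rw [integral_const_mul]
      congr 1
      rw [integral_indicator hBm, setIntegral_const, smul_eq_mul, mul_one]
      rfl
    have i5 : ∫ _ω, ε / 2 ∂P = ε / 2 := by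
      rw [integral_const]; simp
    linarith [i1, i2, i3, i4, i5, step]
  have hb1 : ε / (4 * E) * (∫ ω, En ω ∂P) ≤ ε / 4 := by
    calc ε / (4 * E) * (∫ ω, En ω ∂P) ≤ ε / (4 * E) * E := by gcongr
      _ = ε / 4 := by field_simp
  have hPB : ε ^ 2 / (16 * F ^ 2 * E) ≤ (P B).toReal := by
    have hFKpos : 0 < F * K := mul_pos hF hKpos
    have h5 : ε / 4 ≤ F * K * (P B).toReal := by linarith
    have h6 : ε / 4 / (F * K) ≤ (P B).toReal := by
      rw [div_le_iff₀ hFKpos]; linarith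
    have e2 : ε / 4 / (F * K) = ε ^ 2 / (16 * F ^ 2 * E) := by rw [hK]; field_simp; ring
    linarith [e2 ▸ h6]
  exact (ENNReal.ofReal_le_iff_le_toReal (measure_ne_top P B)).2 hPB

/-- FORCE SIZE ON A BALL: for `c'` within distance `1` of `c₀`, `‖f_{c'}‖₂ ≤ √(#S) (‖c₀‖ + 1)`
(`∫‖f_c‖² ≤ ∑‖c k‖² ≤ #S ‖c‖²`, Disproof §4).  This is what makes the budget inflation `j`-UNIFORM: the window
is shrunk to a ball before the inflated budgets are chosen. [folklore] -/
theorem sqrt_forceEnergy_le {S : Finset (Fin 3 → ℤ)} {c₀ c' : ↥S → ℂ³} (h : dist c' c₀ < 1) :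
    Real.sqrt (∫ y, ‖force S c' y‖ ^ 2) ≤ Real.sqrt (S.card * (‖c₀‖ + 1) ^ 2) := by
  apply Real.sqrt_le_sqrt
  have h1 := integral_norm_sq_force_le S c'
  have h2 := coeffNormSq_le_card_mul c'
  have h3 : ‖c'‖ ≤ ‖c₀‖ + 1 := by
    have h5 := norm_sub_norm_le c' c₀
    rw [dist_eq_norm] at h
    linarith
  have h4 : (S.card : ℝ) * ‖c'‖ ^ 2 ≤ S.card * (‖c₀‖ + 1) ^ 2 := by
    apply mul_le_mul_of_nonneg_left _ (Nat.cast_nonneg _)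
    exact pow_le_pow_left₀ (norm_nonneg _) h3 2
  linarith

/-- A measure carried by `K` charges only `K`: `x ∈ K` for `μ`-a.e. `x`. [folklore] -/
theorem IsInvariantMeasure.ae_mem {K : Set Hsp} {φ : ℝ → Hsp → Hsp} {μ : Measure Hsp}
    (hμ : IsInvariantMeasure K φ μ) : ∀ᵐ x ∂μ, x ∈ K := by
  have h : μ {x | ¬ x ∈ K} = 0 := hμ.null_compl
  exact ae_iff.2 h

/-- An invariant measure carried by `K` stays invariant for any semiflow on a LARGER set that agrees with `φ` on
`[0,∞) × K` (the enlargement of Stub 2 costs nothing on the measure side). [folklore] -/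
theorem IsInvariantMeasure.enlarge {K K' : Set Hsp} {φ φ' : ℝ → Hsp → Hsp} {μ : Measure Hsp}
    (hμ : IsInvariantMeasure K φ μ) (hKK' : K ⊆ K') (hagree : ∀ t : ℝ, 0 ≤ t → ∀ x ∈ K, φ' t x = φ t x) :
    IsInvariantMeasure K' φ' μ where
  prob := hμ.prob
  null_compl := measure_mono_null (compl_subset_compl.2 hKK') hμ.null_compl
  map_eq t ht := by
    have hae : φ' t =ᵐ[μ] φ t := (IsInvariantMeasure.ae_mem hμ).mono fun x hx => hagree t ht x hx
    rw [Measure.map_congr hae, hμ.map_eq t ht]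

end Summit.AnomalousDissipation.AnomalousDissipation.Theorems.DenseLoudDesignerForces.Ergodic

end
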